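import Summits.ValiantsHypothesis.ValiantsHypothesis.Theses.RealTau
import Literature.Computability.AlgebraicComplexity.RealTauKnownCases
import Summits.ValiantsHypothesis.ValiantsHypothesis.Theorems.RealTauRefined.Negative.LoadBearing

/-!
# `RealTau.RealTauRefined` (stmt-ValiantsHypothesis-18101) — negative side, II: tightness at `a = 1`,
# false strengthenings, positive half-line form

Refuter (cdisprove cycle 1, 2026-08-17), from `Cruxes/RealTauRefined/Disproof.lean` Part II §(f)–(h);
companion of `Negative/LoadBearing.lean` (Part I) and of `Negative/FischerPowersLine.lean`,
`Negative/AdditiveCount.lean` (same cycle).  The crux (Tavenas 2014, Conj. 3.23, refined real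
τ-conjecture: `#Z_ℝ(∑_{i<k} ∏_{j<m} f_ij) ≤ 2^(a(m+1)) (k+t+2)^a` for `t`-sparse real `f_ij`) is an open
conjecture and is NOT refuted here.  Certified (elementary; no facts, no `def`s — witnesses are built
inside the proofs):

* `realTauRefined_bound_fails_at_one` — the body at exponent `a = 1` is false: `m = 1`, `k = t = 12`,
  `∏_{i<121} (X - i)` written as 12 blocks of 12 monomials has `121 > 2^2 · 26` distinct real zeros
  (with the block decomposition `sum_blocks_eq` of an arbitrary polynomial).  Together with
  `realTauRefined_bound_fails_at_zero` (Part I): any witness exponent is `≥ 2`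
  (`two_le_of_realTauRefined_exponent`); `a = 2` is not known to fail.
* `not_realTauRefined_withMultiplicity` — the strengthening counting zeros WITH multiplicity
  (`roots.card`) is false (`X^N`); `not_realTauRefined_complex` — the statement over `ℂ` is false
  (`X^N - 1`, `N` distinct roots of unity): the order of `ℝ` is the whole content.
* `realTauRefined_iff_pos` — the crux is equivalent (`a ↦ a+1`) to its positive-half-line form
  (bound only the zeros in `(0,∞)`; `F(-X)` is again `(k,m,t)`-sparse, Mathlib `roots_comp_neg_X`).
[folklore]
-/

set_option linter.dupNamespace false

namespace Summit.ValiantsHypothesis.ValiantsHypothesis.Theorems.RealTauRefined.Negative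

open Polynomial Finset
open Literature.Computability.AlgebraicComplexity
open Summit.ValiantsHypothesis.ValiantsHypothesis.Theses.RealTau

/-! ### tightness one step up: `a = 1` fails -/

/-- A sum of `T` monomials has at most `T` monomials. [folklore] -/
theorem card_support_sum_CXpow_le (T : ℕ) (a : Fin T → ℝ) (e : Fin T → ℕ) :
    (∑ l : Fin T, C (a l) * X ^ (e l)).support.card ≤ T := by
  have h1 := card_support_sum_le (univ : Finset (Fin T)) (fun l => C (a l) * X ^ (e l))
  have h2 : ∑ l : Fin T, (C (a l) * X ^ (e l)).support.card ≤ ∑ _l : Fin T, (1 : ℕ) :=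
    Finset.sum_le_sum fun l _ => card_support_C_mul_X_pow_le_one
  rw [Finset.sum_const, Finset.card_univ, Fintype.card_fin, smul_eq_mul, mul_one] at h2
  exact h1.trans h2

/-- Block decomposition: a polynomial of `natDegree < k t` is the sum of `k` blocks of `t`
consecutive monomials each. [folklore] -/
theorem sum_blocks_eq (P : ℝ[X]) (k t : ℕ) (h : P.natDegree < k * t) :
    (∑ i : Fin k, ∑ l : Fin t, C (P.coeff ((l : ℕ) + t * (i : ℕ))) * X ^ ((l : ℕ) + t * (i : ℕ)))
      = P := by
  calc (∑ i : Fin k, ∑ l : Fin t, C (P.coeff ((l : ℕ) + t * (i : ℕ))) * X ^ ((l : ℕ) + t * (i : ℕ)))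
      = ∑ x : Fin k × Fin t,
          C (P.coeff ((x.2 : ℕ) + t * (x.1 : ℕ))) * X ^ ((x.2 : ℕ) + t * (x.1 : ℕ)) :=
        (Fintype.sum_prod_type' _).symm
    _ = ∑ x : Fin k × Fin t,
          (fun n : Fin (k * t) => C (P.coeff (n : ℕ)) * X ^ (n : ℕ)) (finProdFinEquiv x) := rfl
    _ = ∑ n : Fin (k * t), C (P.coeff (n : ℕ)) * X ^ (n : ℕ) :=
        Equiv.sum_comp finProdFinEquiv (fun n : Fin (k * t) => C (P.coeff (n : ℕ)) * X ^ (n : ℕ))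
    _ = ∑ n ∈ range (k * t), C (P.coeff n) * X ^ n :=
        Fin.sum_univ_eq_sum_range (fun n => C (P.coeff n) * X ^ n) _
    _ = ∑ n ∈ range (k * t), monomial n (P.coeff n) :=
        Finset.sum_congr rfl fun n _ => C_mul_X_pow_eq_monomial
    _ = P := (as_sum_range' P _ h).symm

/-- Helper (`card_support_block_le`). [folklore] -/
theorem card_support_block_le (P : ℝ[X]) (t i : ℕ) :
    (∑ l : Fin t, C (P.coeff ((l : ℕ) + t * i)) * X ^ ((l : ℕ) + t * i)).support.card ≤ t := by
  exact card_support_sum_CXpow_le t (fun l => P.coeff ((l : ℕ) + t * i)) (fun l => (l : ℕ) + t * i)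

/-- Tightness one step up: the body of `RealTauRefined` at exponent `a = 1` (bound
`2^(m+1) (k+t+2)`) is false — witness `m = 1`, `k = t = 12`, `F = ∏_{i<121} (X - i)` cut into 12
blocks of 12 monomials: `121 > 4 · 26 = 104` distinct real zeros.  So any witness exponent for the
crux is `≥ 2` (`a = 2` is not known to fail: every known ΣΠ-sparse family has `O(kmt)` real zeros). [folklore] -/
theorem realTauRefined_bound_fails_at_one :
    ¬ ∀ (k m t : ℕ) (f : Fin k → Fin m → Polynomial ℝ),
      (∀ i j, (f i j).support.card ≤ t) → (∑ i, ∏ j, f i j) ≠ 0 →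
        (∑ i, ∏ j, f i j).roots.toFinset.card ≤ 2 ^ (1 * (m + 1)) * (k + t + 2) ^ 1 := by
  intro ha
  set s : Multiset ℝ := (Multiset.range 121).map ((↑) : ℕ → ℝ) with hs
  set P : Polynomial ℝ := (s.map fun r => X - C r).prod with hP
  have hnd : s.Nodup := (Multiset.nodup_range 121).map Nat.cast_injective
  have hsN : Multiset.card s = 121 := by rw [hs, Multiset.card_map, Multiset.card_range]
  have hcard : P.roots.toFinset.card = 121 := by
    rw [hP, roots_multiset_prod_X_sub_C, Multiset.toFinset_card_of_nodup hnd, hsN]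
  have hP0 : P ≠ 0 := by
    rw [hP]; exact (monic_multiset_prod_of_monic _ _ fun r _ => monic_X_sub_C r).ne_zero
  have hdeg : P.natDegree = 121 := by
    rw [hP, natDegree_multiset_prod_X_sub_C_eq_card, hsN]
  have key : (∑ i : Fin 12, ∏ _j : Fin 1,
      ∑ l : Fin 12, C (P.coeff ((l : ℕ) + 12 * (i : ℕ))) * X ^ ((l : ℕ) + 12 * (i : ℕ))) = P := by
    simp only [Finset.prod_const, Finset.card_univ, Fintype.card_fin, pow_one]
    exact sum_blocks_eq P 12 12 (by rw [hdeg]; norm_num)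
  have h := ha 12 1 12
    (fun i _ => ∑ l : Fin 12, C (P.coeff ((l : ℕ) + 12 * (i : ℕ))) * X ^ ((l : ℕ) + 12 * (i : ℕ)))
    (fun i _ => card_support_block_le P 12 i) (by rw [key]; exact hP0)
  rw [key, hcard] at h
  norm_num at h

/-- Summary of the two tightness lemmas: ANY witness exponent for the crux is at least `2`
(`a = 0`: `realTauRefined_bound_fails_at_zero`, Part I; `a = 1`: `realTauRefined_bound_fails_at_one`).
[folklore] -/
theorem two_le_of_realTauRefined_exponent (a : ℕ)
    (ha : ∀ (k m t : ℕ) (f : Fin k → Fin m → Polynomial ℝ),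
      (∀ i j, (f i j).support.card ≤ t) → (∑ i, ∏ j, f i j) ≠ 0 →
        (∑ i, ∏ j, f i j).roots.toFinset.card ≤ 2 ^ (a * (m + 1)) * (k + t + 2) ^ a) :
    2 ≤ a := by
  by_contra h
  interval_cases a
  · exact realTauRefined_bound_fails_at_zero ha
  · exact realTauRefined_bound_fails_at_one ha

/-! ### natural strengthenings that are false -/

/-- Natural strengthening 1 is false: counting real zeros WITH MULTIPLICITY (`roots.card` in place
of `roots.toFinset.card`) dies on `X^N` (`k = m = t = 1`). (Hrubeš's Conj. 2.1 counts NONZERO roots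
with multiplicity and is equivalent to the crux; the root `0` must be excluded.) [folklore] -/
theorem not_realTauRefined_withMultiplicity :
    ¬ ∃ a : ℕ, ∀ (k m t : ℕ) (f : Fin k → Fin m → Polynomial ℝ),
      (∀ i j, (f i j).support.card ≤ t) → (∑ i, ∏ j, f i j) ≠ 0 →
        Multiset.card (∑ i, ∏ j, f i j).roots ≤ 2 ^ (a * (m + 1)) * (k + t + 2) ^ a := by
  rintro ⟨a, ha⟩
  set N : ℕ := 2 ^ (a * (1 + 1)) * (1 + 1 + 2) ^ a + 1 with hN
  have key : (∑ _i : Fin 1, ∏ _j : Fin 1, C (1 : ℝ) * X ^ N) = X ^ N := by simp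
  have h := ha 1 1 1 (fun _ _ => C (1 : ℝ) * X ^ N) (fun _ _ => card_support_C_mul_X_pow_le_one)
    (by rw [key]; exact pow_ne_zero _ X_ne_zero)
  rw [key, roots_X_pow, Multiset.card_nsmul, Multiset.card_singleton, mul_one] at h
  omega

/-- Natural strengthening 2 is false: the statement over `ℂ` (all complex zeros) dies on `X^N - 1`
(`k = m = 1`, `t = 2`): the ORDER of `ℝ` is the whole content (route rationale). [folklore] -/
theorem not_realTauRefined_complex :
    ¬ ∃ a : ℕ, ∀ (k m t : ℕ) (f : Fin k → Fin m → Polynomial ℂ),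
      (∀ i j, (f i j).support.card ≤ t) → (∑ i, ∏ j, f i j) ≠ 0 →
        (∑ i, ∏ j, f i j).roots.toFinset.card ≤ 2 ^ (a * (m + 1)) * (k + t + 2) ^ a := by
  rintro ⟨a, ha⟩
  set N : ℕ := 2 ^ (a * (1 + 1)) * (1 + 2 + 2) ^ a + 1 with hN
  have hN0 : N ≠ 0 := by omega
  have key : (∑ _i : Fin 1, ∏ _j : Fin 1, ((X : ℂ[X]) ^ N - C 1)) = X ^ N - C 1 := by simp
  have hroots : ((X : ℂ[X]) ^ N - C 1).roots.toFinset.card = N := by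
    have hprim := Complex.isPrimitiveRoot_exp N hN0
    have h1 : ((X : ℂ[X]) ^ N - C 1).roots = nthRoots N (1 : ℂ) := rfl
    rw [h1, Multiset.toFinset_card_of_nodup (IsPrimitiveRoot.nthRoots_one_nodup hprim),
      IsPrimitiveRoot.card_nthRoots_one hprim]
  have hsupp : ((X : ℂ[X]) ^ N - C 1).support.card ≤ 2 := by
    have h1 : ((X : ℂ[X]) ^ N - C 1) = C 1 * X ^ N + C (-1) * X ^ 0 := by
      simp [sub_eq_add_neg]
    rw [h1]
    calc _ ≤ (C (1 : ℂ) * X ^ N).support.card + (C (-1 : ℂ) * X ^ 0).support.card :=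
          (card_le_card support_add).trans (card_union_le _ _)
      _ ≤ 1 + 1 := Nat.add_le_add card_support_C_mul_X_pow_le_one card_support_C_mul_X_pow_le_one
  have h := ha 1 1 2 (fun _ _ => X ^ N - C 1) (fun _ _ => hsupp)
    (by rw [key]; exact X_pow_sub_C_ne_zero (by omega) 1)
  rw [key, hroots] at h
  omega

/-! ### positive half-line normal form -/

/-- Negative zeros of `F` are positive zeros of `F(-X)`, which is again a `(k, m, t)` ΣΠ-sparse
expression. [folklore] -/
theorem card_filter_neg_eq (F : ℝ[X]) :
    (F.roots.toFinset.filter (· < 0)).card = ((F.comp (-X)).roots.toFinset.filter (0 < ·)).card := by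
  rw [roots_comp_neg_X]
  apply le_antisymm
  · refine card_le_card_of_injOn (fun x => -x) ?_ (fun x _ y _ h => neg_injective h)
    intro x hx
    simp only [coe_filter, Set.mem_setOf_eq, Multiset.mem_toFinset, Multiset.mem_map] at hx ⊢
    exact ⟨⟨x, hx.1, rfl⟩, neg_pos.mpr hx.2⟩
  · refine card_le_card_of_injOn (fun x => -x) ?_ (fun x _ y _ h => neg_injective h)
    intro x hx
    simp only [coe_filter, Set.mem_setOf_eq, Multiset.mem_toFinset, Multiset.mem_map] at hx ⊢
    obtain ⟨⟨y, hy, rfl⟩, hx0⟩ := hx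
    exact ⟨by simpa using hy, by linarith⟩

/-- POSITIVE HALF-LINE NORMAL FORM: the crux is equivalent (`a ↦ a + 1`) to bounding only the zeros in
`(0, ∞)` — `F(-X)` is again `(k, m, t)`-sparse and `0` counts once. [folklore] -/
theorem realTauRefined_iff_pos : RealTauRefined ↔
    (∃ a : ℕ, ∀ (k m t : ℕ) (f : Fin k → Fin m → Polynomial ℝ), (∀ i j, (f i j).support.card ≤ t) →
      (∑ i, ∏ j, f i j) ≠ 0 →
        ((∑ i, ∏ j, f i j).roots.toFinset.filter (0 < ·)).card ≤ 2 ^ (a * (m + 1)) * (k + t + 2) ^ a) := by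
  constructor
  · rintro ⟨a, ha⟩
    exact ⟨a, fun k m t f hf hF => (card_filter_le _ _).trans (ha k m t f hf hF)⟩
  · rintro ⟨a, ha⟩
    refine ⟨a + 1, fun k m t f hf hF => ?_⟩
    set F := ∑ i, ∏ j, f i j with hFdef
    set B := 2 ^ (a * (m + 1)) * (k + t + 2) ^ a with hB
    -- positive zeros
    have hpos : (F.roots.toFinset.filter (0 < ·)).card ≤ B := ha k m t f hf hF
    -- negative zeros, via F(-X) = ∑ ∏ f i j (-X)
    have hcomp : F.comp (-X) = ∑ i, ∏ j, (f i j).comp (-X) := by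
      rw [hFdef, ← coe_compRingHom_apply, map_sum]
      refine Finset.sum_congr rfl fun i _ => ?_
      rw [map_prod]
      rfl
    have hF' : (∑ i, ∏ j, (f i j).comp (-X)) ≠ 0 := by
      rw [← hcomp]; exact fun h => hF (comp_neg_X_eq_zero_iff.mp h)
    have hneg : (F.roots.toFinset.filter (· < 0)).card ≤ B := by
      rw [card_filter_neg_eq, hcomp]
      exact ha k m t (fun i j => (f i j).comp (-X)) (fun i j => by rw [support_comp_neg_X]; exact hf i j) hF'
    -- zero
    have hsplit : F.roots.toFinset ⊆
        insert 0 (F.roots.toFinset.filter (· < 0) ∪ F.roots.toFinset.filter (0 < ·)) := by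
      intro x hx
      rcases lt_trichotomy x 0 with h | h | h
      · exact mem_insert_of_mem (mem_union_left _ (mem_filter.mpr ⟨hx, h⟩))
      · simp [h]
      · exact mem_insert_of_mem (mem_union_right _ (mem_filter.mpr ⟨hx, h⟩))
    have hB1 : 1 ≤ B := by rw [hB]; exact Nat.one_le_iff_ne_zero.mpr (by positivity)
    have h2 : 2 ≤ k + t + 2 := by omega
    calc F.roots.toFinset.card
        ≤ (insert (0 : ℝ) (F.roots.toFinset.filter (· < 0) ∪ F.roots.toFinset.filter (0 < ·))).card :=
          card_le_card hsplit
      _ ≤ (F.roots.toFinset.filter (· < 0) ∪ F.roots.toFinset.filter (0 < ·)).card + 1 :=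
          card_insert_le _ _
      _ ≤ B + B + 1 := by
          have := card_union_le (F.roots.toFinset.filter (· < 0)) (F.roots.toFinset.filter (0 < ·))
          omega
      _ ≤ 2 ^ (m + 1) * (k + t + 2) * B := by
          have h4 : 4 * B ≤ 2 ^ (m + 1) * (k + t + 2) * B :=
            Nat.mul_le_mul_right B (by
              calc 4 = 2 * 2 := by norm_num
                _ ≤ 2 ^ (m + 1) * (k + t + 2) :=
                  Nat.mul_le_mul (by
                    calc 2 = 2 ^ 1 := by norm_num
                      _ ≤ 2 ^ (m + 1) := Nat.pow_le_pow_right (by norm_num) (by omega)) h2)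
          omega
      _ = 2 ^ ((a + 1) * (m + 1)) * (k + t + 2) ^ (a + 1) := by
          rw [hB]; ring

end Summit.ValiantsHypothesis.ValiantsHypothesis.Theorems.RealTauRefined.Negative
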